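import Literature.MathematicalPhysics.QuantumLattice.TorusWilsonMarkov
import Summits.QuantumFields.YangMills.Theorems.FradkinShenkerFlowSusceptibilityToPoincareTwoBlockFactorization

/-!
# One-slice bound ∧ conditional bound ⇒ two-slice bound (crux `ConvexGribovBody.PoincareToGap`, line `Sketch`, stub G1)

Torus Wilson state `μ = wilsonMeasure r.ρ β` on `GaugeConfig 4 (2S+1) G`, `P_D := μ[· | cylinderEvents D]` the
conditional expectation given the link variables in a link set `D`.  Three link sets attached to the arc of `ℓ`
time slices starting at time `s`: `X` = the SPATIAL links of slice `s` (time offset `0`), `E` = the spatial links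
of the two END slices (offsets `0` and `ℓ − 1`), `O` = the links OUTSIDE the arc (offset `≥ ℓ`).

`stub_projectionBound_glue`: for `1 ≤ ℓ`, `θ₂ ≤ 1`, if
* (PB1) `Var(P_X h) ≤ θ₁ · Var h` for every bounded measurable gauge-invariant `h` reading links other than `X`,
* (PB2) `‖P_E h − P_X h‖² ≤ θ₂ · ‖h − P_X h‖²` for every bounded measurable gauge-invariant `h` reading only `O`,
then `Var(P_E h) ≤ (θ₁ + θ₂ − θ₁θ₂) · Var h` for every bounded measurable gauge-invariant `h` reading only `O`.

Proof (pure Hilbert-space algebra on a probability space, `projectionBound_glue_abstract`).  `X ⊆ E`, so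
`σ(X) ≤ σ(E)` and the tower property gives `P_X P_E = P_X`; with `c = ∫ h`, `V = ∫ (h − c)²`,
`a = ∫ (P_X h − c)²`, `b = ∫ (P_E h − P_X h)²`, Pythagoras for the projection `P_X` applied to `P_E h − c` and
to `h − c` gives `∫ (P_E h − c)² = a + b` and `∫ (h − P_X h)² = V − a`.  Since `1 ≤ ℓ`, `O` avoids `X`, so PB1
applies to `h`: `a ≤ θ₁ V`; PB2 gives `b ≤ θ₂ (V − a)`; hence
`a + b ≤ θ₂ V + (1 − θ₂) a ≤ θ₂ V + (1 − θ₂) θ₁ V = (θ₁ + θ₂ − θ₁θ₂) V`.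
(The hypothesis `1 ≤ ℓ` is necessary: for `ℓ = 0` one has `E = X`, `O` = all links, and the conclusion would
bound `Var(P_X h)` for gauge-invariant `h` reading `X` itself, which PB1 does not provide.)

References: F. Martinelli, LNM 1717 (1999), §3 (block projections in `L²`); H.-O. Georgii, *Gibbs Measures and
Phase Transitions* (2011), §1.2.
-/

noncomputable section

open scoped BigOperators Topology
open MeasureTheory ProbabilityTheory Filter
open Literature.MathematicalPhysics.QuantumFieldTheory Literature.MathematicalPhysics.QuantumLattice

namespace Summit.QuantumFields.YangMills.Theorems.PoincareToGap

open Summit.QuantumFields.YangMills.Theorems.SusceptibilityToPoincare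

/-! ### Abstract `L²` glue on a probability space -/

section L2

variable {Ω : Type*} {m0 : MeasurableSpace Ω} {μ : Measure Ω}

/-- A measurable real function bounded by `M` is in `L²` of a finite measure. -/
private theorem memLp_two_of_abs_le [IsFiniteMeasure μ] {f : Ω → ℝ} (hf : Measurable f) {M : ℝ}
    (hb : ∀ x, |f x| ≤ M) : MemLp f 2 μ :=
  MemLp.of_bound hf.aestronglyMeasurable M (ae_of_all _ fun x => by rw [Real.norm_eq_abs]; exact hb x)

/-- Conditional expectation commutes with subtracting a constant: `P_m (f − c) = P_m f − c` a.e. -/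
private theorem condExp_sub_const_ae [IsFiniteMeasure μ] {m : MeasurableSpace Ω} (hm : m ≤ m0)
    {f : Ω → ℝ} (hf : Integrable f μ) (c : ℝ) :
    μ[fun ω => f ω - c|m] =ᵐ[μ] fun ω => μ[f|m] ω - c := by
  have e : (fun ω => f ω - c) = f - fun _ => c := rfl
  rw [e]
  refine (condExp_sub hf (integrable_const c) m).trans ?_
  rw [condExp_const hm c]
  exact Eventually.of_forall fun ω => rfl

/-- **Glue, abstract form.**  On a probability space with sub-σ-algebras `m_X ≤ m_E`, let `h ∈ L²`, `c = ∫ h`.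
If `∫ (P_X h − c)² ≤ θ₁ ∫ (h − c)²` and `∫ (P_E h − P_X h)² ≤ θ₂ ∫ (h − P_X h)²` with `θ₂ ≤ 1`, then
`∫ (P_E h − c)² ≤ (θ₁ + θ₂ − θ₁θ₂) ∫ (h − c)²`: by the tower property `P_X (P_E h − c) = P_X h − c`, so
Pythagoras gives `∫ (P_E h − c)² = a + b` and `∫ (h − P_X h)² = V − a` (`a = ∫ (P_X h − c)²`,
`b = ∫ (P_E h − P_X h)²`, `V = ∫ (h − c)²`), and `a + b ≤ a + θ₂ (V − a) ≤ θ₂ V + (1 − θ₂) θ₁ V`. -/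
private theorem projectionBound_glue_abstract [IsProbabilityMeasure μ]
    {mX mE : MeasurableSpace Ω} (hXE : mX ≤ mE) (hE : mE ≤ m0) {θ₁ θ₂ : ℝ} (hθ₂ : θ₂ ≤ 1)
    {h : Ω → ℝ} (hh : MemLp h 2 μ)
    (H1 : ∫ ω, (μ[h|mX] ω - ∫ v, h v ∂μ) ^ 2 ∂μ ≤ θ₁ * ∫ ω, (h ω - ∫ v, h v ∂μ) ^ 2 ∂μ)
    (H2 : ∫ ω, (μ[h|mE] ω - μ[h|mX] ω) ^ 2 ∂μ ≤ θ₂ * ∫ ω, (h ω - μ[h|mX] ω) ^ 2 ∂μ) :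
    ∫ ω, (μ[h|mE] ω - ∫ v, h v ∂μ) ^ 2 ∂μ ≤
      (θ₁ + θ₂ - θ₁ * θ₂) * ∫ ω, (h ω - ∫ v, h v ∂μ) ^ 2 ∂μ := by
  have hX : mX ≤ m0 := hXE.trans hE
  set c := ∫ v, h v ∂μ with hc
  have hi : Integrable h μ := hh.integrable one_le_two
  have hPE : MemLp (μ[h|mE]) 2 μ := hh.condExp one_le_two
  -- tower: `P_X (h − c) = P_X h − c` and `P_X (P_E h − c) = P_X h − c`
  have hPX1 : μ[fun ω => h ω - c|mX] =ᵐ[μ] fun ω => μ[h|mX] ω - c := condExp_sub_const_ae hX hi c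
  have hPX2 : μ[fun ω => μ[h|mE] ω - c|mX] =ᵐ[μ] fun ω => μ[h|mX] ω - c := by
    filter_upwards [condExp_sub_const_ae hX (integrable_condExp (m := mE) (μ := μ) (f := h)) c,
      condExp_condExp_of_le (μ := μ) (f := h) hXE hE] with ω h1 h2
    rw [h1, h2]
  -- Pythagoras for `h − c`: `∫ (h − P_X h)² = V − a`
  have hf1 : MemLp (fun ω => h ω - c) 2 μ := hh.sub (memLp_const c)
  have p1 : ∫ ω, ((h ω - c) - μ[fun ω => h ω - c|mX] ω) ^ 2 ∂μ =
      ∫ ω, (h ω - c) ^ 2 ∂μ - ∫ ω, (μ[fun ω => h ω - c|mX] ω) ^ 2 ∂μ :=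
    TwoBlock.integral_sub_condExp_sq hX hf1
  have e1a : ∫ ω, ((h ω - c) - μ[fun ω => h ω - c|mX] ω) ^ 2 ∂μ = ∫ ω, (h ω - μ[h|mX] ω) ^ 2 ∂μ := by
    refine integral_congr_ae ?_
    filter_upwards [hPX1] with ω hω
    rw [hω]
    ring
  have e1b : ∫ ω, (μ[fun ω => h ω - c|mX] ω) ^ 2 ∂μ = ∫ ω, (μ[h|mX] ω - c) ^ 2 ∂μ :=
    integral_sq_congr_ae hPX1
  rw [e1a, e1b] at p1
  -- Pythagoras for `P_E h − c`: `∫ (P_E h − c)² = a + b`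
  have hf2 : MemLp (fun ω => μ[h|mE] ω - c) 2 μ := hPE.sub (memLp_const c)
  have p2 : ∫ ω, ((μ[h|mE] ω - c) - μ[fun ω => μ[h|mE] ω - c|mX] ω) ^ 2 ∂μ =
      ∫ ω, (μ[h|mE] ω - c) ^ 2 ∂μ - ∫ ω, (μ[fun ω => μ[h|mE] ω - c|mX] ω) ^ 2 ∂μ :=
    TwoBlock.integral_sub_condExp_sq hX hf2
  have e2a : ∫ ω, ((μ[h|mE] ω - c) - μ[fun ω => μ[h|mE] ω - c|mX] ω) ^ 2 ∂μ =
      ∫ ω, (μ[h|mE] ω - μ[h|mX] ω) ^ 2 ∂μ := by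
    refine integral_congr_ae ?_
    filter_upwards [hPX2] with ω hω
    rw [hω]
    ring
  have e2b : ∫ ω, (μ[fun ω => μ[h|mE] ω - c|mX] ω) ^ 2 ∂μ = ∫ ω, (μ[h|mX] ω - c) ^ 2 ∂μ :=
    integral_sq_congr_ae hPX2
  rw [e2a, e2b] at p2
  -- arithmetic
  have key : (1 - θ₂) * ∫ ω, (μ[h|mX] ω - c) ^ 2 ∂μ ≤ (1 - θ₂) * (θ₁ * ∫ ω, (h ω - c) ^ 2 ∂μ) :=
    mul_le_mul_of_nonneg_left H1 (by linarith)
  rw [p1] at H2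
  linarith

end L2

/-! ### The stub -/

/-- `stub_projectionBound_glue` — **one-slice bound ∧ conditional bound ⇒ two-slice bound (G1 of the line
`Sketch`)**.  On one torus, for the arc of `ℓ ≥ 1` slices from `s`, with `X` = the spatial links at time `s`
(offset `0`), `E` = the spatial links of the two end slices (offsets `0`, `ℓ − 1`) and `O` = the links outside the
arc (offset `≥ ℓ`): if `Var(P_X h) ≤ θ₁ Var h` for gauge-invariant bounded measurable `h` reading links other than
`X` (PB1) and `‖P_E h − P_X h‖² ≤ θ₂ ‖h − P_X h‖²` for gauge-invariant bounded measurable `h` reading only `O`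
(PB2, `θ₂ ≤ 1`), then `Var(P_E h) ≤ (θ₁ + θ₂ − θ₁θ₂) Var h` for the latter class.  Proof: `X ⊆ E` gives
`P_X P_E = P_X` (tower), so `Var(P_E h) = Var(P_X h) + ‖P_E h − P_X h‖²` and `‖h − P_X h‖² = Var h − Var(P_X h)`
(Pythagoras); `O ∩ X = ∅` as `ℓ ≥ 1`, so PB1 applies; then `a + θ₂(V − a) ≤ θ₂ V + (1 − θ₂) θ₁ V`
(`projectionBound_glue_abstract`). -/
theorem stub_projectionBound_glue :
    ∀ (G : Type) [Group G] [TopologicalSpace G] [IsTopologicalGroup G] [CompactSpace G]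
      [MeasurableSpace G] [BorelSpace G] (r : LatticeRep G) (β : ℝ) (S : ℕ)
      (μ : Measure (GaugeConfig 4 (2 * S + 1) G)),
      μ = (wilsonMeasure r.ρ β : Measure (GaugeConfig 4 (2 * S + 1) G)) →
    ∀ (s : ZMod (2 * S + 1)) (ℓ : ℕ) (θ₁ θ₂ : ℝ), 0 ≤ θ₁ → 0 ≤ θ₂ → θ₂ ≤ 1 → 1 ≤ ℓ →
    (∀ h : GaugeConfig 4 (2 * S + 1) G → ℝ, Measurable h → (∃ M : ℝ, ∀ U, |h U| ≤ M) →
      IsGaugeInvariant h → DependsOn h {e : Edge 4 (2 * S + 1) | ¬ ((e.1 0 - s).val = 0 ∧ e.2 ≠ 0)} →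
      ∫ U, (condExp (cylinderEvents {e : Edge 4 (2 * S + 1) | (e.1 0 - s).val = 0 ∧ e.2 ≠ 0}) μ h U -
          ∫ V, h V ∂μ) ^ 2 ∂μ ≤ θ₁ * ∫ U, (h U - ∫ V, h V ∂μ) ^ 2 ∂μ) →
    (∀ h : GaugeConfig 4 (2 * S + 1) G → ℝ, Measurable h → (∃ M : ℝ, ∀ U, |h U| ≤ M) →
      IsGaugeInvariant h → DependsOn h {e : Edge 4 (2 * S + 1) | ℓ ≤ (e.1 0 - s).val} →
      ∫ U, (condExp (cylinderEvents {e : Edge 4 (2 * S + 1) |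
              ((e.1 0 - s).val = 0 ∨ (e.1 0 - s).val = ℓ - 1) ∧ e.2 ≠ 0}) μ h U -
            condExp (cylinderEvents {e : Edge 4 (2 * S + 1) | (e.1 0 - s).val = 0 ∧ e.2 ≠ 0}) μ h U) ^ 2 ∂μ ≤
        θ₂ * ∫ U, (h U -
            condExp (cylinderEvents {e : Edge 4 (2 * S + 1) | (e.1 0 - s).val = 0 ∧ e.2 ≠ 0}) μ h U) ^ 2 ∂μ) →
    ∀ h : GaugeConfig 4 (2 * S + 1) G → ℝ, Measurable h → (∃ M : ℝ, ∀ U, |h U| ≤ M) →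
      IsGaugeInvariant h → DependsOn h {e : Edge 4 (2 * S + 1) | ℓ ≤ (e.1 0 - s).val} →
    ∫ U, (condExp (cylinderEvents {e : Edge 4 (2 * S + 1) |
            ((e.1 0 - s).val = 0 ∨ (e.1 0 - s).val = ℓ - 1) ∧ e.2 ≠ 0}) μ h U - ∫ V, h V ∂μ) ^ 2 ∂μ ≤
      (θ₁ + θ₂ - θ₁ * θ₂) * ∫ U, (h U - ∫ V, h V ∂μ) ^ 2 ∂μ := by
  intro G _ _ _ _ _ _ r β S μ hμ s ℓ θ₁ θ₂ _ _ hθ₂ hℓ hPB1 hPB2 h hm hb hGI hdep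
  obtain ⟨M, hM⟩ := hb
  haveI : IsProbabilityMeasure μ := by
    rw [hμ]
    exact isProbabilityMeasure_wilsonMeasure (d := 4) (L := 2 * S + 1) r.ρ r.continuous β
  -- `X ⊆ E`, hence `σ(X) ≤ σ(E)`
  have hXE : {e : Edge 4 (2 * S + 1) | (e.1 0 - s).val = 0 ∧ e.2 ≠ 0} ⊆
      {e : Edge 4 (2 * S + 1) | ((e.1 0 - s).val = 0 ∨ (e.1 0 - s).val = ℓ - 1) ∧ e.2 ≠ 0} :=
    fun e he => ⟨Or.inl he.1, he.2⟩
  -- `O` avoids `X` since `1 ≤ ℓ`, so PB1 applies to `h`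
  have hOX : {e : Edge 4 (2 * S + 1) | ℓ ≤ (e.1 0 - s).val} ⊆
      {e : Edge 4 (2 * S + 1) | ¬ ((e.1 0 - s).val = 0 ∧ e.2 ≠ 0)} := by
    intro e he hx
    have h1 : ℓ ≤ (e.1 0 - s).val := he
    rw [hx.1] at h1
    omega
  have H1 := hPB1 h hm ⟨M, hM⟩ hGI (hdep.mono hOX)
  have H2 := hPB2 h hm ⟨M, hM⟩ hGI hdep
  exact projectionBound_glue_abstract (cylinderEvents_mono hXE) cylinderEvents_le_pi hθ₂
    (memLp_two_of_abs_le hm hM) H1 H2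

end Summit.QuantumFields.YangMills.Theorems.PoincareToGap

end
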